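import Literature.NumberTheory.EllipticCurves.KummerCubeRoots
import Literature.NumberTheory.EllipticCurves.JZeroKolyvaginPrimes
import Literature.NumberTheory.EllipticCurves.HuShuYin2019.SylvesterTowerTwoTorsion
import HarnessLib

/-!
# Kummer independence of the `2`-division fields of Hu–Shu–Yin's pair `(B, A) = (E_p, E_{3p²})` over
# `K = ℚ(ω)`: `X³ + a₆(A)` has no root in `K(θ)` for any root `θ` of `X³ + a₆(B)`, and vice versa

Topic `NumberTheory/EllipticCurves/HuShuYin2019`, namespace `Literature.NumberTheory.EllipticCurves.HuShuYin2019`.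
THEOREMS ONLY (no definition, no named fact, no instance, no notation; D-0014/D-0026). Cell `bsd-cm`, row
`bsd-cm-k-ty1`, fourth seating, FILE 4b (planner D418: «Kummer independence over `K⟮θ⟯`», «`9/2` not a cube»
= this lane); `--supports stmt-BirchSwinnertonDyer-19804`.

For the cube-sum curves `E_n : y² = x³ − 432n²` (`cubeSumCurve n`) one has `a₆(E_p) = −432p² = −6³·2p²`,
`a₆(E_{3p²}) = −3888p⁴ = −(6p)³·18p`, so `K(B[2]) = K(∛(2p²)) = K(∛(4p))` and `K(A[2]) = K(∛(18p))`. The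
Čebotarev input (Z) of the coupled `2`-adic CM-frame Kolyvagin argument (cell memo two §57.4 Steps 3–4; the
tree's `SylvesterTwoCoupledDescentCebotarevHSY.hsy_exists_moving`, hypothesis `hZ`) wants `K(A[2]) ≠ K(B[2])`
in the form: for every root `θ ∈ K̄` of `X³ + a₆(B)` and every `t ∈ K⟮θ⟯`, `t³ + a₆(A) ≠ 0` (and symmetrically).
By Kummer theory (`Kummer.exists_eq_pow_three_mul_pow`: the cubes of `K(∛b)` lying in `K` are `K³·b^{0,1,2}`)
this reduces to three non-cube statements in `K` each way, all instances of `root_intCast_not_mem_ringClassField`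
(`RingClassFieldRadicals.lean`: `ᵏ√(ℓᵃd′) ∉ K[m] ⊇ K` for `k ∤ a`, `ℓ ∤ d′·m·d_K`) at `m = 1` with `ℓ = 2`
(`d_K = −3` odd) or `ℓ = p` (`p ≠ 3`):
  (A|B) `3888p⁴ = c³·(432p²)^j`: `j = 0 ⇒ (c/6p)³ = 18p = 2·9p`; `j = 1 ⇒ c³ = 9p² = p²·9`;
        `j = 2 ⇒ (1/c)³ = 48 = 2⁴·3`;
  (B|A) `432p² = c³·(3888p⁴)^j`: `j = 0 ⇒ (c/6)³ = 2p²`; `j = 1 ⇒ (1/c)³ = 9p²`; `j = 2 ⇒ (1/(cp²))³ = 34992 = 2⁴·3⁷`.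

WHAT IS PROVED (sorry-free; `K` a number field with `ω² + ω + 1 = 0`, `[K:ℚ] = 2` — the route binder):
* `pow_three_ne_two_pow_mul` (`t³ ≠ 2ᵃ·d′` in `K` for `3 ∤ a`, `d′` odd), `pow_three_ne_prime_pow_mul`
  (`t³ ≠ ℓᵃ·d′` in `K` for a prime `ℓ ∤ d_K`, `3 ∤ a`, `ℓ ∤ d′`) — from `root_intCast_not_mem_ringClassField`
  via `ι(K) ⊆ K[1]`;
* `forall_pow_three_add_algebraMap_a₆_ne_zero` (+ `_of_prime`, `_three_mul_sq_…`) — «`X³ + a₆(E_n)` has no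
  root in `K`» in the `algebraMap ℚ K` shape of the clause files' `hX`/`hA6`/`hB6`, keyed on `(ω, [K:ℚ] = 2)`;
* **`pow_three_add_a₆_ne_zero_of_mem_adjoin_of_prime`** — (A|B): `∀ θ : K̄, θ³ + a₆(E_p) = 0 →
  ∀ t ∈ K⟮θ⟯, t³ + a₆(E_{3p²}) ≠ 0`, VERBATIM the `hZ` of `hsy_exists_moving` with `(A, B) = (cubeSumCurve (3p²),
  cubeSumCurve p)`;
* **`pow_three_add_a₆_ne_zero_of_mem_adjoin_of_three_mul_sq`** — (B|A), the roles exchanged.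

HONEST FRAMING: Kummer theory and ramification in `ℚ(√−3)`; nothing about Selmer groups, `Ш` or BSD is asserted;
no summit statement is touched.

## References

* S. Lang, *Algebra*, rev. 3rd ed., GTM 211 (2002), VI §8 Thms. 8.1–8.2 (Kummer theory). [Lang2002]
* D. A. Cox, *Primes of the form x² + ny²*, 2nd ed. (2013), §9.A (p. 180) (`K[m]/K` unramified outside `m`).
  [Cox2013]
* Y. Hu, J. Shu, H. Yin, *An explicit Gross–Zagier formula related to the Sylvester conjecture*, Trans. AMS 372
  (2019); arXiv:1708.05266, §2 (the curves `E_p`, `E_{3p²}`, the fields `K(∛p)`, `K(∛3)`). [HuShuYin2019]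
* B. H. Gross, *Kolyvagin's work on modular elliptic curves*, LMS LN 153 (1991), §9 (Props. 9.1, 9.3: the
  Čebotarev argument with `K(E[p])`). [GrossLMS1991]

## Mathlib / tree search
Tree: `Kummer.exists_eq_pow_three_mul_pow` (`KummerCubeRoots`), `root_intCast_not_mem_ringClassField`
(`RingClassFieldRadicals`), `apply_mem_ringClassField`, `JZero.isImaginaryQuadratic_of_sq_add_self_add_one` /
`odd_discr_…` / `discr_eq_neg_three_…` (`JZeroKolyvaginPrimes`), `JZero.exists_aut_apply_eq_sq` (`IsPrimitiveRoot ω 3`),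
`HuShuYin2019.pow_three_ne_of_mem_ringClassField` (`SylvesterTowerTwoTorsion`). Consumer shape:
`SylvesterTwoCoupledDescentCebotarevHSY.hsy_exists_moving` (k7t-c3x H1, hypothesis `hZ`).
presearch: Kummer independence of `K(∛(4p))`, `K(∛(18p))` — HSY §2 uses `L_{(p)} = K(∛p)`, `K(∛3)` and their
independence implicitly [corpus:paper:arxiv-1708.05266 §2]; the generic statement is Lang VI §8 / Childress Thm. 6.2.1.
-/

noncomputable section

open NumberField IntermediateField

namespace Literature.NumberTheory.EllipticCurves.HuShuYin2019

open Literature.NumberTheory.EllipticCurves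

variable {K : Type} [Field K] [NumberField K]

/-! ### Non-cubes in `K = ℚ(ω)` -/

/-- **`2ᵃ·d′` (`3 ∤ a`, `d′` odd) is not a cube in `K`** for `K` imaginary quadratic with odd discriminant
(`2` unramified): the case `m = 1` of `pow_three_ne_of_mem_ringClassField`, read back along an embedding
`ι : K → K[1] ⊂ ℂ`. [cite: Cox2013, §9.A (p. 180)] -/
theorem pow_three_ne_two_pow_mul (hK : IsImaginaryQuadratic K) (hdK : Odd (NumberField.discr K))
    {a : ℕ} (ha : ¬ 3 ∣ a) {d' : ℤ} (hd' : Odd d') (t : K) : t ^ 3 ≠ (2 : K) ^ a * (d' : K) := by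
  obtain ⟨ι⟩ := (inferInstance : Nonempty (K →+* ℂ))
  intro ht
  apply pow_three_ne_of_mem_ringClassField hK ι hdK odd_one ha hd' (apply_mem_ringClassField ι 1 t)
  rw [← map_pow, ht, map_mul, map_pow, map_intCast, map_ofNat]

/-- **`ℓᵃ·d′` (`3 ∤ a`, `ℓ ∤ d′`) is not a cube in `K`** for a prime `ℓ ∤ d_K` (`ℓ` unramified in `K`
imaginary quadratic): `root_intCast_not_mem_ringClassField` at `m = 1`, `k = 3`, read back along
`ι : K → K[1]`. [cite: Cox2013, §9.A (p. 180)] -/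
theorem pow_three_ne_prime_pow_mul (hK : IsImaginaryQuadratic K) {ℓ : ℕ} (hℓ : ℓ.Prime)
    (hℓD : ¬ (ℓ : ℤ) ∣ NumberField.discr K) {a : ℕ} (ha : ¬ 3 ∣ a) {d' : ℤ} (hd' : ¬ (ℓ : ℤ) ∣ d')
    (t : K) : t ^ 3 ≠ (ℓ : K) ^ a * (d' : K) := by
  obtain ⟨ι⟩ := (inferInstance : Nonempty (K →+* ℂ))
  intro ht
  refine root_intCast_not_mem_ringClassField hK ι one_ne_zero hℓ (by simpa using hℓ.one_lt.ne')
    hℓD ha hd' (ι t) ?_ (apply_mem_ringClassField ι 1 t)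
  rw [← map_pow, ht, map_mul, map_pow, map_intCast, map_natCast]

/-! ### «`X³ + a₆` has no root in `K`» in the `algebraMap ℚ K` shape, keyed on `(ω, [K:ℚ] = 2)` -/

/-- **`∀ t : K, t³ + a₆(E_n) ≠ 0`** for `n` an odd integer and `K = ℚ(ω)` (`ω² + ω + 1 = 0`, `[K:ℚ] = 2`),
with `a₆` pushed along `algebraMap ℚ K` — VERBATIM the hypothesis `hX`/`hA6`/`hB6`
(`∀ t : K, t ^ 3 + algebraMap ℚ K X.a₆ ≠ 0`) of the (L3) clause files
(`SylvesterTwoCoupledDescentCebotarevHSY.hsy_curve_package`, `…CebotarevHSYFree`) at `X = cubeSumCurve n`;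
`forall_pow_three_add_a₆_ne_zero` (`SylvesterTowerTwoTorsion`) re-keyed through
`JZero.isImaginaryQuadratic_of_sq_add_self_add_one` / `odd_discr_…`. [cite: HuShuYin2019, §2]
[cite: Cox2013, §9.A (p. 180)] -/
theorem forall_pow_three_add_algebraMap_a₆_ne_zero {ω : K} (hω : ω ^ 2 + ω + 1 = 0)
    (h2 : Module.finrank ℚ K = 2) {n : ℚ} (hn : ∃ n₀ : ℤ, Odd n₀ ∧ (n₀ : ℚ) = n) :
    ∀ t : K, t ^ 3 + algebraMap ℚ K (cubeSumCurve n).a₆ ≠ 0 :=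
  forall_pow_three_add_a₆_ne_zero (JZero.isImaginaryQuadratic_of_sq_add_self_add_one hω h2)
    (JZero.odd_discr_of_sq_add_self_add_one hω h2) hn

/-- `∀ t : K, t³ + a₆(E_p) ≠ 0` for `p` an odd prime (`B = E_p`), `algebraMap ℚ K` shape.
[cite: HuShuYin2019, §2] -/
theorem forall_pow_three_add_algebraMap_a₆_ne_zero_of_prime {ω : K} (hω : ω ^ 2 + ω + 1 = 0)
    (h2 : Module.finrank ℚ K = 2) {p : ℕ} (hp : p.Prime) (hp2 : p ≠ 2) :
    ∀ t : K, t ^ 3 + algebraMap ℚ K (cubeSumCurve (p : ℚ)).a₆ ≠ 0 :=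
  forall_pow_three_add_algebraMap_a₆_ne_zero hω h2
    ⟨p, by exact_mod_cast hp.odd_of_ne_two hp2, by push_cast; rfl⟩

/-- `∀ t : K, t³ + a₆(E_{3p²}) ≠ 0` for `p` an odd prime (`A = E_{3p²}`), `algebraMap ℚ K` shape.
[cite: HuShuYin2019, §2] -/
theorem forall_pow_three_add_algebraMap_a₆_three_mul_sq_ne_zero {ω : K} (hω : ω ^ 2 + ω + 1 = 0)
    (h2 : Module.finrank ℚ K = 2) {p : ℕ} (hp : p.Prime) (hp2 : p ≠ 2) :
    ∀ t : K, t ^ 3 + algebraMap ℚ K (cubeSumCurve (3 * (p : ℚ) ^ 2)).a₆ ≠ 0 :=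
  forall_pow_three_add_algebraMap_a₆_ne_zero hω h2
    ⟨3 * (p : ℤ) ^ 2, (by decide : Odd (3 : ℤ)).mul (by exact_mod_cast (hp.odd_of_ne_two hp2).pow),
      by push_cast; rfl⟩

/-! ### The pair `(B, A) = (E_p, E_{3p²})`: Kummer independence both ways -/

/-- A prime `p ≡ 1 (mod 3)` is `≠ 3`. [folklore] -/
private theorem p_ne_three {p : ℕ} (hp3 : p % 3 = 1) : p ≠ 3 := by rintro rfl; norm_num at hp3

/-- A prime `p ≡ 1 (mod 3)` is odd. [folklore] -/
private theorem p_odd {p : ℕ} (hp : p.Prime) (hp3 : p % 3 = 1) : Odd p :=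
  hp.odd_of_ne_two (by rintro rfl; norm_num at hp3)

/-- A prime `p ≡ 1 (mod 3)` does not divide `9`. [folklore] -/
private theorem not_p_dvd_nine {p : ℕ} (hp : p.Prime) (hp3 : p % 3 = 1) : ¬ (p : ℤ) ∣ 9 := by
  intro h
  have : p ∣ 9 := by exact_mod_cast h
  have h' : p ∣ 3 ^ 2 := by norm_num; exact this
  have := (Nat.prime_dvd_prime_iff_eq hp Nat.prime_three).mp (hp.dvd_of_dvd_pow h')
  exact p_ne_three hp3 this

/-- `432 p² ≠ 0` and `3888 p⁴ ≠ 0` in a field of characteristic `0`. [folklore] -/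
private theorem mul_pow_natCast_ne_zero {n : ℕ} (hn : n ≠ 0) (a : ℕ) (ha : a ≠ 0) (k : ℕ) :
    ((a : K) * (n : K) ^ k) ≠ 0 :=
  mul_ne_zero (by exact_mod_cast ha) (pow_ne_zero _ (by exact_mod_cast hn))

section Pair

variable {ω : K} (hω : ω ^ 2 + ω + 1 = 0) (h2 : Module.finrank ℚ K = 2) {p : ℕ} (hp : p.Prime)
  (hp3 : p % 3 = 1)
include hω h2 hp hp3

/-- `p ∤ d_K = −3` for a prime `p ≡ 1 (mod 3)` (`K = ℚ(ω)`). [folklore] -/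
private theorem not_p_dvd_discr : ¬ (p : ℤ) ∣ NumberField.discr K := by
  rw [JZero.discr_eq_neg_three_of_sq_add_self_add_one hω h2]
  intro h
  have h3 : (p : ℤ) ∣ 3 := by simpa using h
  have : p ∣ 3 := by exact_mod_cast h3
  rcases (Nat.dvd_prime Nat.prime_three).mp this with h1 | h3'
  · exact hp.one_lt.ne' h1
  · exact p_ne_three hp3 h3'

/-- `18p`, `9p²`, `48` are not cubes in `K = ℚ(ω)` (`p` prime `≡ 1 (mod 3)`): the three residual equations
of the Kummer reduction (A|B). [cite: Cox2013, §9.A (p. 180)] [cite: Lang2002, VI §8 Thms. 8.1–8.2] -/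
theorem ne_pow_three_mul_pow_of_prime (c : K) (j : ℕ) (hj : j < 3) :
    (3888 * (p : K) ^ 4 : K) ≠ c ^ 3 * (432 * (p : K) ^ 2) ^ j := by
  have hK := JZero.isImaginaryQuadratic_of_sq_add_self_add_one hω h2
  have hdK := JZero.odd_discr_of_sq_add_self_add_one hω h2
  have hp0 : (p : K) ≠ 0 := by exact_mod_cast hp.ne_zero
  intro h
  interval_cases j
  · -- `3888 p⁴ = c³` ⇒ `(c/(6p))³ = 2 · 9p`
    refine pow_three_ne_two_pow_mul hK hdK (a := 1) (by norm_num) (d' := 9 * p)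
      (by exact (by decide : Odd (9 : ℤ)).mul (by exact_mod_cast p_odd hp hp3)) (c / (6 * p)) ?_
    push_cast
    field_simp
    linear_combination -h
  · -- `3888 p⁴ = c³ · 432p²` ⇒ `c³ = p² · 9`
    refine pow_three_ne_prime_pow_mul hK hp (not_p_dvd_discr hω h2 hp hp3) (a := 2) (by norm_num)
      (d' := 9) (not_p_dvd_nine hp hp3) c ?_
    push_cast
    have : c ^ 3 * (432 * (p : K) ^ 2) = 9 * (p : K) ^ 2 * (432 * (p : K) ^ 2) := by
      linear_combination -h
    have h432 : (432 * (p : K) ^ 2) ≠ 0 := mul_pow_natCast_ne_zero hp.ne_zero 432 (by norm_num) 2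
    have := mul_right_cancel₀ h432 this
    linear_combination this
  · -- `3888 p⁴ = c³ · (432p²)²` ⇒ `(1/c)³ = 2⁴ · 3`
    have hc : c ≠ 0 := by
      rintro rfl
      have : (3888 * (p : K) ^ 4 : K) = 0 := by rw [h]; ring
      exact mul_pow_natCast_ne_zero hp.ne_zero 3888 (by norm_num) 4 this
    refine pow_three_ne_two_pow_mul hK hdK (a := 4) (by norm_num) (d' := 3) (by decide) (1 / c) ?_
    push_cast
    field_simp
    have : c ^ 3 * (432 ^ 2 * (p : K) ^ 4) = 3888 * (p : K) ^ 4 := by linear_combination -h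
    have hp4 : ((p : K) ^ 4) ≠ 0 := pow_ne_zero _ hp0
    have h' : c ^ 3 * 432 ^ 2 = 3888 := by
      have := this
      have e : (c ^ 3 * 432 ^ 2) * (p : K) ^ 4 = 3888 * (p : K) ^ 4 := by linear_combination this
      exact mul_right_cancel₀ hp4 e
    linear_combination (-1 / 3888 : K) * h'

/-- `2p²`, `9p²`, `2⁴·3⁷` are not cubes in `K = ℚ(ω)` (`p` prime `≡ 1 (mod 3)`): the three residual equations
of the Kummer reduction (B|A). [cite: Cox2013, §9.A (p. 180)] [cite: Lang2002, VI §8 Thms. 8.1–8.2] -/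
theorem ne_pow_three_mul_pow_of_three_mul_sq (c : K) (j : ℕ) (hj : j < 3) :
    (432 * (p : K) ^ 2 : K) ≠ c ^ 3 * (3888 * (p : K) ^ 4) ^ j := by
  have hK := JZero.isImaginaryQuadratic_of_sq_add_self_add_one hω h2
  have hdK := JZero.odd_discr_of_sq_add_self_add_one hω h2
  have hp0 : (p : K) ≠ 0 := by exact_mod_cast hp.ne_zero
  intro h
  interval_cases j
  · -- `432p² = c³` ⇒ `(c/6)³ = 2 · p²`
    refine pow_three_ne_two_pow_mul hK hdK (a := 1) (by norm_num) (d' := (p : ℤ) ^ 2)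
      (by exact_mod_cast (p_odd hp hp3).pow) (c / 6) ?_
    push_cast
    field_simp
    linear_combination -h
  · -- `432p² = c³ · 3888p⁴` ⇒ `(1/c)³ = p² · 9`
    have hc : c ≠ 0 := by
      rintro rfl
      have : (432 * (p : K) ^ 2 : K) = 0 := by rw [h]; ring
      exact mul_pow_natCast_ne_zero hp.ne_zero 432 (by norm_num) 2 this
    refine pow_three_ne_prime_pow_mul hK hp (not_p_dvd_discr hω h2 hp hp3) (a := 2) (by norm_num)
      (d' := 9) (not_p_dvd_nine hp hp3) (1 / c) ?_
    push_cast
    field_simp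
    have e : (c ^ 3 * (9 * (p : K) ^ 2)) * (432 * (p : K) ^ 2) = 1 * (432 * (p : K) ^ 2) := by
      linear_combination -h
    have h432 : (432 * (p : K) ^ 2) ≠ 0 := mul_pow_natCast_ne_zero hp.ne_zero 432 (by norm_num) 2
    have := mul_right_cancel₀ h432 e
    linear_combination -this
  · -- `432p² = c³ · (3888p⁴)²` ⇒ `(1/(c p²))³ = 2⁴ · 3⁷`
    have hc : c ≠ 0 := by
      rintro rfl
      have : (432 * (p : K) ^ 2 : K) = 0 := by rw [h]; ring
      exact mul_pow_natCast_ne_zero hp.ne_zero 432 (by norm_num) 2 this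
    refine pow_three_ne_two_pow_mul hK hdK (a := 4) (by norm_num) (d' := 3 ^ 7) (by decide)
      (1 / (c * (p : K) ^ 2)) ?_
    push_cast
    field_simp
    have e : (c ^ 3 * (p : K) ^ 6 * (2 ^ 4 * 3 ^ 7)) * (432 * (p : K) ^ 2) = 1 * (432 * (p : K) ^ 2) := by
      linear_combination -h
    have h432 : (432 * (p : K) ^ 2) ≠ 0 := mul_pow_natCast_ne_zero hp.ne_zero 432 (by norm_num) 2
    have := mul_right_cancel₀ h432 e
    linear_combination -this

/-- **Kummer independence (A|B) for Hu–Shu–Yin's pair — the hypothesis `hZ` of the Čebotarev input (Z).**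
For `K` a number field with `ω² + ω + 1 = 0`, `[K:ℚ] = 2`, and a prime `p ≡ 1 (mod 3)`: for every root
`θ ∈ K̄` of `X³ + a₆(E_p)` (`a₆(E_p) = −432p²`) and every `t ∈ K⟮θ⟯`, `t³ + a₆(E_{3p²}) ≠ 0`
(`a₆(E_{3p²}) = −3888p⁴`); i.e. `∛(18p) ∉ K(∛(4p))`: `K(A[2]) ⊄ K(B[2])` for `(B, A) = (E_p, E_{3p²})`.
VERBATIM the `hZ` of `SylvesterTwoCoupledDescentCebotarevHSY.hsy_exists_moving` at
`(A, B) = (cubeSumCurve (3p²), cubeSumCurve p)`. [cite: Lang2002, VI §8 Thms. 8.1–8.2]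
[cite: HuShuYin2019, §2] [cite: GrossLMS1991, §9 Prop. 9.3] -/
theorem pow_three_add_a₆_ne_zero_of_mem_adjoin_of_prime :
    ∀ θ : AlgebraicClosure K,
      θ ^ 3 + algebraMap ℚ (AlgebraicClosure K) (cubeSumCurve (p : ℚ)).a₆ = 0 →
      ∀ t : AlgebraicClosure K, t ∈ IntermediateField.adjoin K {θ} →
        t ^ 3 + algebraMap ℚ (AlgebraicClosure K) (cubeSumCurve (3 * (p : ℚ) ^ 2)).a₆ ≠ 0 := by
  intro θ hθ t ht hta
  have hζ : IsPrimitiveRoot ω 3 := (JZero.exists_aut_apply_eq_sq K hω h2).1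
  have e : ∀ q : ℚ, algebraMap ℚ (AlgebraicClosure K) q = algebraMap K (AlgebraicClosure K) (q : K) :=
    fun q ↦ by rw [eq_ratCast, map_ratCast]
  have hθ' : θ ^ 3 = algebraMap K (AlgebraicClosure K) (432 * (p : K) ^ 2) := by
    have : θ ^ 3 = -(algebraMap ℚ (AlgebraicClosure K) (cubeSumCurve (p : ℚ)).a₆) :=
      eq_neg_of_add_eq_zero_left hθ
    rw [this, ← map_neg, e]
    congr 1
    simp only [cubeSumCurve]
    push_cast
    ring
  have hta' : t ^ 3 = algebraMap K (AlgebraicClosure K) (3888 * (p : K) ^ 4) := by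
    have : t ^ 3 = -(algebraMap ℚ (AlgebraicClosure K) (cubeSumCurve (3 * (p : ℚ) ^ 2)).a₆) :=
      eq_neg_of_add_eq_zero_left hta
    rw [this, ← map_neg, e]
    congr 1
    simp only [cubeSumCurve]
    push_cast
    ring
  obtain ⟨c, j, hj, h⟩ := Kummer.exists_eq_pow_three_mul_pow hζ hθ' ht hta'
  exact ne_pow_three_mul_pow_of_prime hω h2 hp hp3 c j hj h

/-- **Kummer independence (B|A)** — the roles exchanged: for every root `θ ∈ K̄` of `X³ + a₆(E_{3p²})` and
every `t ∈ K⟮θ⟯`, `t³ + a₆(E_p) ≠ 0`; i.e. `∛(4p) ∉ K(∛(18p))`. VERBATIM the `hZ` of `hsy_exists_moving` at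
`(A, B) = (cubeSumCurve p, cubeSumCurve (3p²))`. [cite: Lang2002, VI §8 Thms. 8.1–8.2] [cite: HuShuYin2019, §2]
[cite: GrossLMS1991, §9 Prop. 9.3] -/
theorem pow_three_add_a₆_ne_zero_of_mem_adjoin_of_three_mul_sq :
    ∀ θ : AlgebraicClosure K,
      θ ^ 3 + algebraMap ℚ (AlgebraicClosure K) (cubeSumCurve (3 * (p : ℚ) ^ 2)).a₆ = 0 →
      ∀ t : AlgebraicClosure K, t ∈ IntermediateField.adjoin K {θ} →
        t ^ 3 + algebraMap ℚ (AlgebraicClosure K) (cubeSumCurve (p : ℚ)).a₆ ≠ 0 := by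
  intro θ hθ t ht hta
  have hζ : IsPrimitiveRoot ω 3 := (JZero.exists_aut_apply_eq_sq K hω h2).1
  have e : ∀ q : ℚ, algebraMap ℚ (AlgebraicClosure K) q = algebraMap K (AlgebraicClosure K) (q : K) :=
    fun q ↦ by rw [eq_ratCast, map_ratCast]
  have hθ' : θ ^ 3 = algebraMap K (AlgebraicClosure K) (3888 * (p : K) ^ 4) := by
    have : θ ^ 3 = -(algebraMap ℚ (AlgebraicClosure K) (cubeSumCurve (3 * (p : ℚ) ^ 2)).a₆) :=
      eq_neg_of_add_eq_zero_left hθ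
    rw [this, ← map_neg, e]
    congr 1
    simp only [cubeSumCurve]
    push_cast
    ring
  have hta' : t ^ 3 = algebraMap K (AlgebraicClosure K) (432 * (p : K) ^ 2) := by
    have : t ^ 3 = -(algebraMap ℚ (AlgebraicClosure K) (cubeSumCurve (p : ℚ)).a₆) :=
      eq_neg_of_add_eq_zero_left hta
    rw [this, ← map_neg, e]
    congr 1
    simp only [cubeSumCurve]
    push_cast
    ring
  obtain ⟨c, j, hj, h⟩ := Kummer.exists_eq_pow_three_mul_pow hζ hθ' ht hta'
  exact ne_pow_three_mul_pow_of_three_mul_sq hω h2 hp hp3 c j hj h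

end Pair

end Literature.NumberTheory.EllipticCurves.HuShuYin2019
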